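import Summits.ResolutionOfSingularities.ResolutionOfSingularities.Theorems.WeightedInvariantLocalWeightedDropTrackCDefs
import Literature.AlgebraicGeometry.Resolution.MonomialOrderReductionUnit
import Literature.AlgebraicGeometry.Resolution.AdicQuotient

/-!
# Track C, the blow-up step OFF the centre: frames are transported along the local isomorphism

[OURS · L1 W4.3 · chain w43, stub worker 4] Helper for TRACK C of the engine crux `LocalWeightedDrop`
(stmt-ResolutionOfSingularities-8899; skeleton `L/res-L1-w43-stub-4/TrackC_Skeleton.lean`, lemma L2, off-centre case).
NOT a statement of any manuscript.

For a blow-up `τ : Z'' ⟶ Z'` along `C` and a point `z ∉ V(C)`: `z` has a preimage `x'` (`IsBlowup.isIso_compl`) at which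
the stalk map is an isomorphism (`IsBlowup.isIso_stalkMap_of_not_mem_support`); a Cohen frame at `z` transports to
`x'` (`adicCompletionCongr`) with the SAME total transform read in the frame. Hence the `WonAt` conclusion at `z` for
`σ` follows from `WonAt f (τ ≫ σ)`: `won_of_wonAt_blowup_of_not_mem_support`.
-/

noncomputable section

open CategoryTheory AlgebraicGeometry TopologicalSpace IsLocalRing
open Literature.AlgebraicGeometry.Resolution

set_option linter.dupNamespace false -- mandated namespace of this single-conjunct summit

namespace Summit.ResolutionOfSingularities.ResolutionOfSingularities.Theorems.TrackC

variable {k : Type} [Field k]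

/-- Off the centre a blow-up is surjective: a point `z ∉ V(C)` has a preimage. [OURS · folklore] -/
theorem exists_preimage_of_not_mem_support {Z' Z'' : Scheme.{0}} {C : Z'.IdealSheafData} {τ : Z'' ⟶ Z'}
    (hτ : IsBlowup τ C) {z : Z'} (hz : z ∉ C.support) : ∃ x' : Z'', τ x' = z := by
  set W : Z'.Opens := ⟨(C.support : Set Z')ᶜ, C.support.isClosed.isOpen_compl⟩ with hW
  haveI : IsIso (τ ∣_ W) := hτ.isIso_compl
  let e := Scheme.homeoOfIso (asIso (τ ∣_ W))
  obtain ⟨y, hy⟩ := e.surjective ⟨z, hz⟩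
  refine ⟨y.1, ?_⟩
  have h1 : ((τ ∣_ W) y).1 = τ y.1 := morphismRestrict_base_coe τ W y
  have h2 : (τ ∣_ W) y = e y := rfl
  rw [← h1, h2, hy]

/-- **The step OFF the centre.** For a blow-up `τ : Z'' ⟶ Z'` along `C` and `z ∉ V(C)`, `WonAt f (τ ≫ σ)` gives the
`WonAt` conclusion at `z` for `σ`: the frame is transported along the isomorphism `𝒪_{Z',z} ≅ 𝒪_{Z'',x'}` at a preimage
`x'`, with the same total transform. [OURS · folklore] -/
theorem won_of_wonAt_blowup_of_not_mem_support (f : MvPowerSeries (Fin 3) k)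
    {Z' Z'' : Scheme.{0}} (σ : Z' ⟶ Spec (.of (MvPowerSeries (Fin 3) k))) (C : Z'.IdealSheafData)
    (τ : Z'' ⟶ Z') (hτ : IsBlowup τ C) (h : WonAt f (τ ≫ σ)) {z : Z'} (hz : z ∉ C.support)
    (hN : IsNoetherianRing (Z'.presheaf.stalk z)) (F : @Frame k _ Z' σ z hN) (g : MvPowerSeries (Fin 3) k)
    (hg : g ∣ F.e (algebraMap _ _ (totalGerm σ z f))) (hs : CobordantGame.IsSingular k g) :
    CobordantGame.Won k 3 g := by
  obtain ⟨x', rfl⟩ := exists_preimage_of_not_mem_support hτ hz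
  haveI := hτ.isIso_stalkMap_of_not_mem_support (x' := x') hz
  haveI := hN
  -- the stalk isomorphism and its completion
  let ε : Z'.presheaf.stalk (τ x') ≃+* Z''.presheaf.stalk x' := (asIso (τ.stalkMap x')).commRingCatIsoToRingEquiv
  have hε : ∀ a, ε a = (τ.stalkMap x').hom a := fun a => rfl
  haveI hN'' : IsNoetherianRing (Z''.presheaf.stalk x') := isNoetherianRing_of_ringEquiv _ ε
  have hmax : (maximalIdeal (Z'.presheaf.stalk (τ x'))).map ε.toRingHom = maximalIdeal (Z''.presheaf.stalk x') :=
    map_ringEquiv_maximalIdeal ε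
  let εh := adicCompletionCongr _ _ ε hmax
  -- germs along `τ`
  have hgerm : ∀ s : Γ(Z', ⊤), (Z''.presheaf.germ ⊤ x' trivial).hom (τ.appTop.hom s) =
      ε ((Z'.presheaf.germ ⊤ (τ x') trivial).hom s) := fun s => by
    rw [hε]
    exact (Scheme.Hom.germ_stalkMap_apply τ ⊤ x' trivial s).symm
  -- the transported frame
  let F'' : @Frame k _ Z'' (τ ≫ σ) x' hN'' :=
    { e := εh.symm.trans F.e
      map_const := fun a => by
        have h1 : stalkConst (τ ≫ σ) x' a = ε (stalkConst σ (τ x') a) := by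
          change (Z''.presheaf.germ ⊤ x' trivial).hom ((τ ≫ σ).appTop.hom _) = _
          rw [Scheme.Hom.comp_appTop, CommRingCat.comp_apply, hgerm]
          rfl
        change F.e (εh.symm (AdicCompletion.of _ _ (stalkConst (τ ≫ σ) x' a))) = _
        rw [h1, ← adicCompletionCongr_of _ _ ε hmax, RingEquiv.symm_apply_apply]
        exact F.map_const a }
  refine h x' hN'' F'' g ?_ hs
  -- same total transform
  have h2 : totalGerm (τ ≫ σ) x' f = ε (totalGerm σ (τ x') f) := by
    change (Z''.presheaf.germ ⊤ x' trivial).hom ((τ ≫ σ).appTop.hom _) = _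
    rw [Scheme.Hom.comp_appTop, CommRingCat.comp_apply, hgerm]
    rfl
  change g ∣ F.e (εh.symm (AdicCompletion.of _ _ (totalGerm (τ ≫ σ) x' f)))
  rw [h2, ← adicCompletionCongr_of _ _ ε hmax, RingEquiv.symm_apply_apply]
  exact hg

end Summit.ResolutionOfSingularities.ResolutionOfSingularities.Theorems.TrackC

end
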